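import Mathlib
import Summits.KontsevichZagierPeriods.KontsevichZagierPeriods.Theorems.SoloInformedScaleIntegrable
import Summits.KontsevichZagierPeriods.KontsevichZagierPeriods.Theorems.SoloInformedHookPoly
import HarnessLib
import HarnessLib.Audit

/-!
# SoloInformed — the hook identities: hook stages and their scale pre-data (F3b)

Solo programme `solo-KontsevichZagierPeriods-informed`, session s54 (PROGRAMME LIII).

A HOOK STAGE is a block labelling `β` (blocks `0,…,K`, partially valid), a position `pos ≤ K`
with a coordinate `a` in block `pos`, a list `bs` of coordinates already placed after `a`
(`soloInformedHookSum`), and a DECREASING CHAIN `c, cs` of coordinates still hanging: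
`w_c > w_{cs₀} > w_{cs₁} > ⋯`.  Its scale band step (THEOREM XLIX, `SoloInformedScaleDatum.scale`)
has active coordinate `A = lastD a bs`, `Φ = HookSum(bs) = P/Q` (`soloInformedHookPQ`, file F3a),
`ω = X_c`, `C = ∏_{t ∈ cs} (1 − X_t)` and cylinder `D = (0,1)^N ∩ {chain}`:

  `A-side  [D ∩ {x_c < x_A},  HookSum(bs)/(∏_{t ∈ cs}(1 − x_t)·(1 − x_c))]`
  `B-side  [D,  HookSum(bs ++ [c])/∏_{t ∈ cs}(1 − x_t)]`           (`soloInformed_hookSum_step`),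

and the `B`-side of the stage `(bs; c, c' :: cs')` IS the `A`-side of the next stage
`(bs ++ [c]; c', cs')` (same domain, same integrand: `next_DA`, `next_fA`).  The analytic fields of
the pre-datum (`SoloInformedHookStage.pre`) are file F3a (`Q > 0` on closed active fibres,
monotonicity of `t ↦ tΦ`); the integrability of each `B`-side is propagated from the `A`-side by
`SoloInformedScalePre.integrableOn_fB` (file F2): `next_integrableOn`.  The chain of all stages is
the next file (`SoloInformedHookStage.chain`).

References: M. Kaneko, S. Yamamoto, arXiv:1605.03117, Thm 4.1, Prop. 5.4; M. Hoffman, Pacific J.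
Math. 152 (1992) Thm 5.1; Kontsevich–Zagier 2001 §1.2 [KontsevichZagier2001].
-/

noncomputable section

open MeasureTheory Set MvPolynomial
open Literature.ModelTheory.ExponentialFields Literature.NumberTheory.Transcendental
open Literature.NumberTheory.Transcendental.KZ

namespace Summit.KontsevichZagierPeriods.KontsevichZagierPeriods.Theorems

/-! ## 1. Decreasing chains of coordinates; the last placed coordinate -/

section chain

variable {N : ℕ}

/-- The decreasing chain below `c`: `{w | w_c > w_{cs₀} > w_{cs₁} > ⋯}`. -/
def soloInformedChainSet : Fin N → List (Fin N) → Set (Fin N → ℝ)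
  | _, [] => univ
  | c, c' :: cs => {w | w c' < w c} ∩ soloInformedChainSet c' cs

/-- No coordinate below `c`: no condition. -/
@[simp] theorem soloInformedChainSet_nil (c : Fin N) : soloInformedChainSet c [] = univ := rfl

/-- One more coordinate below `c`. -/
@[simp] theorem soloInformedChainSet_cons (c c' : Fin N) (cs : List (Fin N)) :
    soloInformedChainSet c (c' :: cs) = {w | w c' < w c} ∩ soloInformedChainSet c' cs := rfl

/-- The chain condition only involves the coordinates `c :: cs`. -/
theorem soloInformed_chainSet_congr : ∀ (c : Fin N) (cs : List (Fin N)) {w w' : Fin N → ℝ},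
    (∀ l ∈ c :: cs, w l = w' l) →
      (w ∈ soloInformedChainSet c cs ↔ w' ∈ soloInformedChainSet c cs)
  | c, [], w, w', _ => by simp
  | c, c' :: cs, w, w', h => by
    simp only [soloInformedChainSet_cons, mem_inter_iff, mem_setOf_eq]
    rw [h c (by simp), h c' (by simp),
      soloInformed_chainSet_congr c' cs fun l hl => h l (List.mem_cons_of_mem c hl)]

/-- `(0,1)^N ∩ {chain}` is `ℚ`-semialgebraic. -/
theorem soloInformed_isSemialgebraic_cube_chain : ∀ (c : Fin N) (cs : List (Fin N)),
    IsSemialgebraic ℚ (soloInformedOpenCube N ∩ soloInformedChainSet c cs)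
  | c, [] => by simpa using isSemialgebraic_soloInformedOpenCube N
  | c, c' :: cs => by
    have h1 : IsSemialgebraic ℚ {w : Fin N → ℝ | w c' < w c} := by
      simpa using isSemialgebraic_setOf_eval_lt (k := ℚ) (R := ℝ)
        (X c' : MvPolynomial (Fin N) ℚ) (X c)
    have h := (soloInformed_isSemialgebraic_cube_chain c' cs).inter h1
    convert h using 1
    ext w
    simp only [soloInformedChainSet_cons, mem_inter_iff, mem_setOf_eq]
    tauto

/-- `lastD a (bs ++ [c]) = c`. -/
theorem soloInformed_lastD_append (c : Fin N) : ∀ (a : Fin N) (bs : List (Fin N)),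
    soloInformedLastD a (bs ++ [c]) = c
  | a, [] => rfl
  | a, b :: bs => by
    rw [List.cons_append, soloInformedLastD_cons]
    exact soloInformed_lastD_append c b bs

/-- `lastD a bs ∈ a :: bs`. -/
theorem soloInformed_lastD_mem : ∀ (a : Fin N) (bs : List (Fin N)),
    soloInformedLastD a bs ∈ a :: bs
  | a, [] => by simp
  | a, b :: bs => by
    rw [soloInformedLastD_cons]
    exact List.mem_cons_of_mem a (soloInformed_lastD_mem b bs)

end chain

/-! ## 2. Hook stages -/

/-- **A hook stage**: labelling `β` with blocks `0,…,K`, position `pos ≤ K` of the coordinate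
`a`, the coordinates `bs` placed after `a`, and the decreasing chain `c, cs` of hanging
coordinates (`c` on top, placed by this stage); all of `bs ++ c :: cs` unplaced in `β` and
pairwise distinct. -/
structure SoloInformedHookStage (N : ℕ) where
  /-- the labelling -/
  β : Fin N → ℕ
  /-- the last block -/
  K : ℕ
  /-- the block of `a` -/
  pos : ℕ
  /-- the coordinate after which placement started -/
  a : Fin N
  /-- the coordinates placed so far, in placement order -/
  bs : List (Fin N)
  /-- the top hanging coordinate (placed by this stage) -/
  c : Fin N
  /-- the hanging coordinates below `c`, top-down -/
  cs : List (Fin N)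
  /-- partial validity of `β` -/
  isLabK : soloInformedIsLabK β K
  /-- `pos ≤ K` -/
  pos_le : pos ≤ K
  /-- `a` lies in block `pos` -/
  β_a : β a = pos
  /-- all of `bs ++ c :: cs` are unplaced in `β` -/
  lt_β : ∀ x ∈ bs ++ c :: cs, K < β x
  /-- and pairwise distinct -/
  nodup : (bs ++ c :: cs).Nodup

namespace SoloInformedHookStage

variable {N : ℕ} (S : SoloInformedHookStage N)

/-- The active coordinate: the last placed one. -/
def A : Fin N := soloInformedLastD S.a S.bs

/-- `bs` are unplaced. -/
theorem lt_β_bs : ∀ x ∈ S.bs, S.K < S.β x := fun x hx => S.lt_β x (List.mem_append_left _ hx)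

/-- `bs` is duplicate-free. -/
theorem nodup_bs : S.bs.Nodup := S.nodup.of_append_left

/-- `bs ++ [c]` are unplaced. -/
theorem lt_β_bsc : ∀ x ∈ S.bs ++ [S.c], S.K < S.β x := fun x hx => by
  rcases List.mem_append.1 hx with h | h
  · exact S.lt_β_bs x h
  · rw [List.mem_singleton.1 h]
    exact S.lt_β _ (by simp)

/-- `bs ++ [c]` is duplicate-free. -/
theorem nodup_bsc : (S.bs ++ [S.c]).Nodup :=
  S.nodup.sublist ((List.Sublist.refl S.bs).append (by simp))

/-- `c :: cs` is duplicate-free. -/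
theorem nodup_ccs : (S.c :: S.cs).Nodup := S.nodup.of_append_right

/-- The active coordinate is not hanging. -/
theorem A_not_mem : S.A ∉ S.c :: S.cs := by
  intro h
  rcases List.mem_cons.1 (soloInformed_lastD_mem S.a S.bs) with hAa | hAbs
  · have h1 : S.K < S.β S.A := S.lt_β _ (List.mem_append_right _ h)
    rw [show S.A = S.a from hAa, S.β_a] at h1
    exact absurd S.pos_le (not_le.2 h1)
  · exact List.disjoint_of_nodup_append S.nodup hAbs h

/-- `A ≠ c`. -/
theorem A_ne_c : S.A ≠ S.c := fun h => S.A_not_mem (by rw [h]; exact List.mem_cons_self)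

/-- `A ∉ cs`. -/
theorem A_ne_of_mem {t : Fin N} (ht : t ∈ S.cs) : S.A ≠ t :=
  fun h => S.A_not_mem (by rw [h]; exact List.mem_cons_of_mem _ ht)

/-- The passive product `C = ∏_{t ∈ cs} (1 − X_t)`. -/
def Cpoly : MvPolynomial (Fin N) ℚ := ∏ t ∈ S.cs.toFinset, (1 - X t)

/-- `C(x) = ∏_{t ∈ cs} (1 − x_t)`. -/
theorem aeval_Cpoly (x : Fin N → ℝ) :
    (aeval x S.Cpoly : ℝ) = ∏ t ∈ S.cs.toFinset, (1 - x t) := by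
  simp [Cpoly, map_prod]

/-- The variables of `C` are among `cs`. -/
theorem vars_Cpoly_subset : S.Cpoly.vars ⊆ S.cs.toFinset := by
  refine (vars_prod _).trans (Finset.biUnion_subset.2 fun t ht => ?_)
  refine (vars_sub_subset (1 : MvPolynomial (Fin N) ℚ) (q := X t)).trans ?_
  rw [vars_one, vars_X, Finset.empty_union]
  exact Finset.singleton_subset_iff.2 ht

/-! ## 3. The step datum of a stage -/

/-- **The scale pre-datum of a hook stage**: active `A`, `Φ = HookSum(bs) = P/Q`, `ω = X_c`,
`C = ∏_{t ∈ cs}(1 − X_t)`, `D = (0,1)^N ∩ {chain}`. -/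
def pre : SoloInformedScalePre N where
  i := S.A
  P := (soloInformedHookPQ S.β S.K S.pos S.bs).1
  Q := (soloInformedHookPQ S.β S.K S.pos S.bs).2
  Ω := X S.c
  C := S.Cpoly
  D := soloInformedOpenCube N ∩ soloInformedChainSet S.c S.cs
  isSemialgebraic_D := soloInformed_isSemialgebraic_cube_chain S.c S.cs
  update_mem x hx t h0 h1 := by
    refine ⟨fun j => ?_, ?_⟩
    · by_cases hj : j = S.A
      · subst hj; simp [h0, h1]
      · rw [Function.update_of_ne hj]; exact hx.1 j
    · refine (soloInformed_chainSet_congr S.c S.cs fun l hl => ?_).1 hx.2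
      have hl' : l ≠ S.A := fun e => S.A_not_mem (e ▸ hl)
      rw [Function.update_of_ne hl']
  mem_Ioo x hx := hx.1 S.A
  vars_Ω := by
    rw [vars_X, Finset.mem_singleton]
    exact S.A_ne_c
  vars_C h := S.A_ne_of_mem (List.mem_toFinset.1 (S.vars_Cpoly_subset h)) rfl
  Ω_bound x hx := by simpa using hx.1 S.c
  C_pos x hx := by
    rw [aeval_Cpoly]
    exact Finset.prod_pos fun t _ => sub_pos.2 (hx.1 t).2
  Q_ne x hx t ht :=
    (soloInformed_hookPQ_snd_pos S.isLabK S.pos_le S.lt_β_bs S.nodup_bs hx.1 S.A ht).ne'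
  mono x hx := soloInformed_hookPQ_mono S.isLabK S.pos_le S.lt_β_bs S.nodup_bs hx.1 S.A

/-- Auxiliary (hook stage): the active slot of the pre-datum. -/
@[simp] theorem pre_i : S.pre.i = S.A := rfl
/-- Auxiliary (hook stage): `P`. -/
@[simp] theorem pre_P : S.pre.P = (soloInformedHookPQ S.β S.K S.pos S.bs).1 := rfl
/-- Auxiliary (hook stage): `Q`. -/
@[simp] theorem pre_Q : S.pre.Q = (soloInformedHookPQ S.β S.K S.pos S.bs).2 := rfl
/-- Auxiliary (hook stage): `Ω = X_c`. -/
@[simp] theorem pre_Ω : S.pre.Ω = X S.c := rfl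
/-- Auxiliary (hook stage): `C`. -/
@[simp] theorem pre_C : S.pre.C = S.Cpoly := rfl
/-- Auxiliary (hook stage): `D`. -/
@[simp] theorem pre_D : S.pre.D = soloInformedOpenCube N ∩ soloInformedChainSet S.c S.cs := rfl

/-- **The `A`-domain** `D_A = (0,1)^N ∩ {chain} ∩ {x_c < x_A}`. -/
theorem pre_DA : S.pre.T₀.DA =
    soloInformedOpenCube N ∩ soloInformedChainSet S.c S.cs ∩ {x | x S.c < x S.A} := by
  ext x
  simp [SoloInformedScaleDatum.DA, SoloInformedScaleDatum.ω, SoloInformedScalePre.T₀, pre]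

/-- **The `A`-integrand** on the cube: `f_A = HookSum(bs)/(∏_{t ∈ cs}(1 − x_t)·(1 − x_c))`. -/
theorem pre_fA {x : Fin N → ℝ} (hx : x ∈ soloInformedOpenCube N) :
    S.pre.fA x = soloInformedHookSum x S.β S.K S.pos S.bs /
      ((∏ t ∈ S.cs.toFinset, (1 - x t)) * (1 - x S.c)) := by
  have hx' : ∀ l, 0 < x l ∧ x l < 1 := hx
  simp only [SoloInformedScalePre.fA, SoloInformedScalePre.φ, SoloInformedScaleDatum.cc,
    SoloInformedScaleDatum.ω, SoloInformedScalePre.T₀_Q, SoloInformedScalePre.T₀_C,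
    SoloInformedScalePre.T₀_Ω, pre_P, pre_Q, pre_Ω, pre_C, aeval_X, aeval_Cpoly]
  rw [soloInformed_hookPQ_div_open S.isLabK S.pos_le S.lt_β_bs S.nodup_bs hx']

/-- **The `B`-integrand** on the cube: `f_B = HookSum(bs ++ [c])/∏_{t ∈ cs}(1 − x_t)`
[`soloInformed_hookSum_step`]. -/
theorem pre_fB {x : Fin N → ℝ} (hx : x ∈ soloInformedOpenCube N) :
    S.pre.fB x = soloInformedHookSum x S.β S.K S.pos (S.bs ++ [S.c]) /
      ∏ t ∈ S.cs.toFinset, (1 - x t) := by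
  have hx' : ∀ l, 0 < x l ∧ x l < 1 := hx
  have hc1 : (1 - x S.c) ≠ 0 := (sub_pos.2 (hx' S.c).2).ne'
  have hu : ∀ l, 0 < Function.update x S.A (x S.c * x S.A) l ∧
      Function.update x S.A (x S.c * x S.A) l < 1 := by
    intro l
    by_cases hl : l = S.A
    · subst hl
      simp only [Function.update_self]
      exact ⟨mul_pos (hx' _).1 (hx' _).1,
        mul_lt_one_of_nonneg_of_lt_one_left (hx' _).1.le (hx' _).2 (hx' _).2.le⟩
    · rw [Function.update_of_ne hl]; exact hx' l
  have step := soloInformed_hookSum_step hx' S.bs S.β S.K S.pos S.a S.isLabK S.pos_le S.β_a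
    S.lt_β_bsc S.nodup_bsc
  simp only [SoloInformedScalePre.fB, soloInformedScaleFB, SoloInformedScalePre.T₀_Q,
    SoloInformedScalePre.T₀_C, SoloInformedScalePre.T₀_Ω, SoloInformedScalePre.T₀_i, pre_i, pre_P,
    pre_Q, pre_Ω, pre_C, aeval_X, aeval_Cpoly]
  rw [soloInformed_hookPQ_div_open S.isLabK S.pos_le S.lt_β_bs S.nodup_bs hx',
    soloInformed_hookPQ_div_open S.isLabK S.pos_le S.lt_β_bs S.nodup_bs hu,
    mul_comm (x S.c) (x S.A)]
  change _ = soloInformedHookSum x S.β S.K S.pos (S.bs ++ [S.c]) / _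
  rw [← mul_div_mul_right _ (∏ t ∈ S.cs.toFinset, (1 - x t)) hc1, step]
  rfl

/-- The `A`-side integrability from its explicit form. -/
theorem integrableOn_fA_of (h : IntegrableOn (fun x => soloInformedHookSum x S.β S.K S.pos S.bs /
      ((∏ t ∈ S.cs.toFinset, (1 - x t)) * (1 - x S.c)))
      (soloInformedOpenCube N ∩ soloInformedChainSet S.c S.cs ∩ {x | x S.c < x S.A})) :
    IntegrableOn S.pre.fA S.pre.T₀.DA := by
  have hm := S.pre.T₀.measurableSet_DA
  rw [pre_DA] at hm ⊢
  exact h.congr_fun (fun x hx => (S.pre_fA hx.1.1).symm) hm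

/-! ## 4. The next stage -/

/-- **The next stage**: `c` joins the placed coordinates, `c'` becomes the top of the chain. -/
def next (c' : Fin N) (cs' : List (Fin N)) (h : S.cs = c' :: cs') : SoloInformedHookStage N where
  β := S.β
  K := S.K
  pos := S.pos
  a := S.a
  bs := S.bs ++ [S.c]
  c := c'
  cs := cs'
  isLabK := S.isLabK
  pos_le := S.pos_le
  β_a := S.β_a
  lt_β x hx := S.lt_β x (by rw [h]; simpa using hx)
  nodup := by have hn := S.nodup; rw [h] at hn; simpa using hn

variable (c' : Fin N) (cs' : List (Fin N)) (h : S.cs = c' :: cs')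

/-- The active coordinate of the next stage is `c`. -/
theorem next_A : (S.next c' cs' h).A = S.c := soloInformed_lastD_append S.c S.a S.bs

/-- **Same domain**: `D_A(next) = D`. -/
theorem next_DA : (S.next c' cs' h).pre.T₀.DA = S.pre.T₀.D := by
  rw [pre_DA, next_A, SoloInformedScalePre.T₀_D, pre_D, h]
  ext x
  simp only [next, soloInformedChainSet_cons, mem_inter_iff, mem_setOf_eq]
  tauto

/-- **Same integrand**: `f_A(next) = f_B` on `D`. -/
theorem next_fA {x : Fin N → ℝ} (hx : x ∈ S.pre.T₀.D) :
    S.pre.fB x = (S.next c' cs' h).pre.fA x := by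
  have hxc : x ∈ soloInformedOpenCube N := hx.1
  rw [S.pre_fB hxc, (S.next c' cs' h).pre_fA hxc]
  have hc' : c' ∉ cs'.toFinset := fun hm => by
    have hn := S.nodup_ccs
    rw [h] at hn
    exact (List.nodup_cons.1 (List.nodup_cons.1 hn).2).1 (List.mem_toFinset.1 hm)
  simp only [next, h, List.toFinset_cons, Finset.prod_insert hc']
  ring

/-- The `A`-side of the next stage is integrable if the `A`-side of this stage is. -/
theorem next_integrableOn (hA : IntegrableOn S.pre.fA S.pre.T₀.DA) :
    IntegrableOn (S.next c' cs' h).pre.fA (S.next c' cs' h).pre.T₀.DA := by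
  rw [next_DA]
  exact (S.pre.integrableOn_fB hA).congr_fun (fun x hx => S.next_fA c' cs' h hx)
    S.pre.T₀.measurableSet_D

end SoloInformedHookStage

end Summit.KontsevichZagierPeriods.KontsevichZagierPeriods.Theorems
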